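import Literature.MathematicalPhysics.QuantumLattice.KomaTasakiSSBProofs

/-!
# Koma–Tasaki 1994, Theorem 2.4 (Anderson tower): definitions for the proof of Section 5

Towards the proof of the named fact `theorem_2_4` of `KomaTasakiSSB.lean` (T. Koma, H. Tasaki,
J. Stat. Phys. **76** (1994) 745–803, `KomaTasaki1994`, Section 5 "Proof of second theorem").

Section 5 of the paper manipulates expectation values
`ω(O^{σ₁} ⋯ O^{σ_k} A O^{σ_{k+1}} ⋯ O^{σ_{K+L}})` of ordered products of the raising/lowering
operators `O^± = O⁽¹⁾ ± i O⁽²⁾` around a "local" operator `A = Σ_x a_x`. This file sets up the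
bookkeeping for an abstract `U1System` (no state `Φ` yet):

* `sgnOp s` (`O⁺` for `s = true`, `O⁻` for `s = false`), `wordOp w = Π_i O^{w_i}` for a word
  `w : List Bool`, the reversed-flipped word `wrev w` (the adjoint word: `⟪Π_w x, y⟫ = ⟪x, Π_{wrev w} y⟫`),
  the charge `wordCharge w = #⁺ - #⁻`;
* the `U(1)` charge calculus `HasCharge X q : C X - X C = q X` ((2.16): `O^±` have charge `±1`),
  `C Π_w = Π_w C + charge(w) Π_w`;
* norm bounds `‖O^±‖ ≤ 2 o N`, `‖Π_w‖ ≤ (2 o N)^{|w|}`;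
* local operators `IsLocal A a` (`A = Σ_x a_x`, `‖a_x‖ ≤ a`, `[a_x, o_y^{(α)}] = 0` for `y ∉ S_x`;
  KT p. 784 "Let `A` be an operator written as `A = Σ a_x` …") and the key closure property
  `IsLocal A a → IsLocal [O^±, A] (4 r o a)` (KT p. 787: "`‖[Σ_{y∈S_x} o^±_y, a_x]‖ ≤ 4rao`");
* the remaining definitions used by the proof: the `π`-rotation `U = exp[i(π/√γ) O⁽¹⁾]` of
  hypothesis vi) (`U1System.rotation`), the quantity `oN`, the standing hypotheses `TowerState`
  of Section 5 on the state `Φ`, the numbers `c_m = 4^m (m!)²/(2m)!`, `b_m = c_m ω((O⁽¹⁾)^{2m})`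
  of Lemma 13 (KT (5.1)), the smallness condition `KLCond` (5.12) and the error `delta` =
  `δ(A; K, L)` (5.14) of Lemma 14.

The local densities `o^±_y` (`oPlus`, `oMinus`), the bound `‖O⁺‖ ≤ 2oN` and the mirror system
(`O⁺ ↔ O⁻`, used for `M < 0`) are those of `KomaTasakiSSBProofs` (proof of Theorem 2.3).

All theorems about these objects (the consequences of vi), Lemma 13, Lemmas 14–15 and the proof of
Theorem 2.4) are in the sibling files `KomaTasakiTowerExp`, `KomaTasakiTowerState`,
`KomaTasakiTowerAverage`, `KomaTasakiTowerHardLemma`, `KomaTasakiSSBTowerProofs`.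
-/

noncomputable section

open Complex Finset
open scoped InnerProductSpace ComplexConjugate

namespace Literature.MathematicalPhysics.QuantumLattice.KomaTasaki

universe u v

variable {Λ : Type u} [Fintype Λ] {E : Type v} [NormedAddCommGroup E] [InnerProductSpace ℂ E]

namespace U1System

variable (sys : U1System Λ E)

/-! ### Signed ladder operators and words -/

/-- The sign `±1` of a letter: `true ↦ +1` (raising), `false ↦ -1` (lowering). [folklore] -/
def bsign : Bool → ℤ
  | true => 1
  | false => -1

/-- `bsign true = 1`. [folklore] -/
@[simp] theorem bsign_true : bsign true = 1 := rfl
/-- `bsign false = -1`. [folklore] -/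
@[simp] theorem bsign_false : bsign false = -1 := rfl
/-- Flipping a letter flips its sign. [folklore] -/
@[simp] theorem bsign_not (s : Bool) : bsign (!s) = -bsign s := by cases s <;> rfl

/-- `O^s`: the raising operator `O⁺` for `s = true`, the lowering operator `O⁻` for `s = false`
(KT (2.15), and `O^σ` of Lemma 14). [cite: KomaTasaki1994, (2.15)] -/
def sgnOp : Bool → (E →L[ℂ] E)
  | true => sys.orderPlus
  | false => sys.orderMinus

/-- `O^{true} = O⁺`. [cite: KomaTasaki1994, (2.15)] -/
@[simp] theorem sgnOp_true : sys.sgnOp true = sys.orderPlus := rfl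
/-- `O^{false} = O⁻`. [cite: KomaTasaki1994, (2.15)] -/
@[simp] theorem sgnOp_false : sys.sgnOp false = sys.orderMinus := rfl

/-- The local densities `o^±_y` of `O^± = Σ_y o^±_y`, indexed by the sign: `o⁺_y = oPlus y`,
`o⁻_y = oMinus y` (both from `KomaTasakiSSBProofs`). [cite: KomaTasaki1994, §4 (4.3)] -/
def sgnDensity : Bool → Λ → (E →L[ℂ] E)
  | true => sys.oPlus
  | false => sys.oMinus

/-- `o^{+}_y = oPlus y`. [cite: KomaTasaki1994, §4 (4.3)] -/
@[simp] theorem sgnDensity_true (y : Λ) : sys.sgnDensity true y = sys.oPlus y := rfl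
/-- `o^{-}_y = oMinus y`. [cite: KomaTasaki1994, §4 (4.3)] -/
@[simp] theorem sgnDensity_false (y : Λ) : sys.sgnDensity false y = sys.oMinus y := rfl

/-- `O⁻ = Σ_y o⁻_y` (the companion of `orderPlus_eq_sum_oPlus`). [cite: KomaTasaki1994, §4 (4.3)] -/
theorem orderMinus_eq_sum_oMinus : sys.orderMinus = ∑ y, sys.oMinus y := by
  simp only [orderMinus, order, oMinus, Finset.sum_sub_distrib, Finset.smul_sum]

/-- `O^± = Σ_y o^±_y`. [cite: KomaTasaki1994, §4 (4.3)] -/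
theorem sgnOp_eq_sum (s : Bool) : sys.sgnOp s = ∑ y, sys.sgnDensity s y := by
  cases s
  · exact sys.orderMinus_eq_sum_oMinus
  · exact sys.orderPlus_eq_sum_oPlus

/-- `‖o^±_y‖ ≤ 2 o` (hypothesis iii)). [cite: KomaTasaki1994, §2.3 iii)] -/
theorem norm_sgnDensity_le (s : Bool) (y : Λ) : ‖sys.sgnDensity s y‖ ≤ 2 * sys.obar := by
  cases s
  · exact sys.norm_oMinus_le y
  · exact sys.norm_oPlus_le y

/-- `o^±_y` commutes with `o^{(β)}_z` for `z ≠ y` (hypothesis i)). [cite: KomaTasaki1994, §2.3 i)] -/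
theorem commute_sgnDensity_o (s : Bool) {y z : Λ} (h : y ≠ z) (β : Fin 2) :
    Commute (sys.sgnDensity s y) (sys.o β z) := by
  have h0 := sys.commute_o y z h 0 β
  have h1 := sys.commute_o y z h 1 β
  cases s
  · exact h0.sub_left (h1.smul_left I)
  · exact h0.add_left (h1.smul_left I)

/-- `‖O^±‖ ≤ 2 o N`. [cite: KomaTasaki1994, §5 (proof of Lemma 14)] -/
theorem norm_sgnOp_le (s : Bool) : ‖sys.sgnOp s‖ ≤ 2 * sys.obar * Fintype.card Λ := by
  rw [sgnOp_eq_sum]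
  calc ‖∑ y, sys.sgnDensity s y‖ ≤ ∑ y, ‖sys.sgnDensity s y‖ := norm_sum_le _ _
    _ ≤ ∑ _y : Λ, 2 * sys.obar := Finset.sum_le_sum fun y _ => sys.norm_sgnDensity_le s y
    _ = 2 * sys.obar * Fintype.card Λ := by
        rw [Finset.sum_const, Finset.card_univ, nsmul_eq_mul]; ring

/-- `‖O⁽α⁾‖ ≤ o N`. [cite: KomaTasaki1994, §5 (5.4)] -/
theorem norm_order_le (α : Fin 2) : ‖sys.order α‖ ≤ sys.obar * Fintype.card Λ := by
  calc ‖sys.order α‖ = ‖∑ y, sys.o α y‖ := rfl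
    _ ≤ ∑ y, ‖sys.o α y‖ := norm_sum_le _ _
    _ ≤ ∑ _y : Λ, sys.obar := Finset.sum_le_sum fun y _ => sys.norm_o_le α y
    _ = sys.obar * Fintype.card Λ := by
        rw [Finset.sum_const, Finset.card_univ, nsmul_eq_mul]; ring

/-- The ordered product `Π_w := O^{w₁} O^{w₂} ⋯ O^{wₙ}` of a word `w` (KT's `∏ O^{σ_i}`).
[cite: KomaTasaki1994, §5 Lemma 14] -/
def wordOp (w : List Bool) : E →L[ℂ] E := (w.map sys.sgnOp).prod

/-- The empty word is the identity. [folklore] -/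
@[simp] theorem wordOp_nil : sys.wordOp [] = 1 := rfl

/-- `Π_{s :: w} = O^s Π_w`. [folklore] -/
@[simp] theorem wordOp_cons (s : Bool) (w : List Bool) :
    sys.wordOp (s :: w) = sys.sgnOp s * sys.wordOp w := by
  simp [wordOp]

/-- `Π_{[s]} = O^s`. [folklore] -/
theorem wordOp_singleton (s : Bool) : sys.wordOp [s] = sys.sgnOp s := by simp

/-- `Π_{u ++ v} = Π_u Π_v`. [folklore] -/
@[simp] theorem wordOp_append (u v : List Bool) :
    sys.wordOp (u ++ v) = sys.wordOp u * sys.wordOp v := by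
  simp [wordOp, List.prod_append]

/-- `Π_{s^n} = (O^s)^n`. [folklore] -/
theorem wordOp_replicate (n : ℕ) (s : Bool) : sys.wordOp (List.replicate n s) = sys.sgnOp s ^ n := by
  induction n with
  | zero => simp
  | succ n ih => rw [List.replicate_succ, wordOp_cons, ih, pow_succ']

/-- The charge `#{i : wᵢ = +} - #{i : wᵢ = -}` of a word. [cite: KomaTasaki1994, §5 Lemma 14] -/
def wordCharge (w : List Bool) : ℤ := (w.count true : ℤ) - (w.count false : ℤ)

omit [Fintype Λ] in
/-- The empty word has charge `0`. [folklore] -/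
@[simp] theorem wordCharge_nil : wordCharge [] = 0 := by simp [wordCharge]

/-- `charge(s :: w) = sign(s) + charge(w)`. [folklore] -/
@[simp] theorem wordCharge_cons (s : Bool) (w : List Bool) :
    wordCharge (s :: w) = bsign s + wordCharge w := by
  cases s <;> simp [wordCharge] <;> ring

/-- `charge(u ++ v) = charge(u) + charge(v)`. [folklore] -/
@[simp] theorem wordCharge_append (u v : List Bool) :
    wordCharge (u ++ v) = wordCharge u + wordCharge v := by
  simp only [wordCharge, List.count_append]; push_cast; ring

/-- `charge(s^n) = n sign(s)`. [folklore] -/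
theorem wordCharge_replicate (n : ℕ) (s : Bool) :
    wordCharge (List.replicate n s) = n * bsign s := by
  induction n with
  | zero => simp
  | succ n ih => rw [List.replicate_succ, wordCharge_cons, ih]; push_cast; ring

/-- The adjoint word: reversed with all signs flipped (`(O^{σ₁}⋯O^{σₙ})† = O^{-σₙ}⋯O^{-σ₁}`).
[folklore] -/
def wrev (w : List Bool) : List Bool := (w.map (!·)).reverse

omit [Fintype Λ] in
/-- `wrev [] = []`. [folklore] -/
@[simp] theorem wrev_nil : wrev [] = [] := rfl

omit [Fintype Λ] in
/-- `wrev (s :: w) = wrev w ++ [¬s]`. [folklore] -/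
@[simp] theorem wrev_cons (s : Bool) (w : List Bool) : wrev (s :: w) = wrev w ++ [!s] := by
  simp [wrev]

omit [Fintype Λ] in
/-- `wrev (u ++ v) = wrev v ++ wrev u`. [folklore] -/
@[simp] theorem wrev_append (u v : List Bool) : wrev (u ++ v) = wrev v ++ wrev u := by
  simp [wrev]

omit [Fintype Λ] in
/-- `wrev` is an involution. [folklore] -/
@[simp] theorem wrev_wrev (w : List Bool) : wrev (wrev w) = w := by
  simp [wrev, List.map_reverse, Function.comp_def]

omit [Fintype Λ] in
/-- `wrev` preserves length. [folklore] -/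
@[simp] theorem length_wrev (w : List Bool) : (wrev w).length = w.length := by simp [wrev]

omit [Fintype Λ] in
/-- `wrev` exchanges the numbers of `+` and `-`. [folklore] -/
theorem count_wrev (w : List Bool) (s : Bool) : (wrev w).count s = w.count (!s) := by
  induction w with
  | nil => simp
  | cons t w ih =>
      rw [wrev_cons, List.count_append, ih, List.count_cons, List.count_cons, List.count_nil]
      cases s <;> cases t <;> simp

omit [Fintype Λ] in
/-- `wrev (s^n) = (¬s)^n`. [folklore] -/
@[simp] theorem wrev_replicate (n : ℕ) (s : Bool) :
    wrev (List.replicate n s) = List.replicate n (!s) := by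
  simp [wrev]

/-! ### Adjoints: `(O^±)† = O^∓` -/

/-- `⟪O^s x, y⟫ = ⟪x, O^{-s} y⟫` (the `o^{(α)}_x` are self-adjoint). [cite: KomaTasaki1994, §2.3] -/
theorem inner_sgnOp_left (s : Bool) (x y : E) :
    ⟪sys.sgnOp s x, y⟫_ℂ = ⟪x, sys.sgnOp (!s) y⟫_ℂ := by
  have h0 : ⟪sys.order 0 x, y⟫_ℂ = ⟪x, sys.order 0 y⟫_ℂ := sys.isSymmetric_order 0 x y
  have h1 : ⟪sys.order 1 x, y⟫_ℂ = ⟪x, sys.order 1 y⟫_ℂ := sys.isSymmetric_order 1 x y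
  cases s
  · simp only [sgnOp_false, Bool.not_false, sgnOp_true, orderMinus, orderPlus,
      sub_apply, add_apply,
      smul_apply, inner_sub_left, inner_add_right, inner_smul_left,
      inner_smul_right, h0, h1, Complex.conj_I]
    ring
  · simp only [sgnOp_false, Bool.not_true, sgnOp_true, orderMinus, orderPlus,
      sub_apply, add_apply,
      smul_apply, inner_sub_right, inner_add_left, inner_smul_left,
      inner_smul_right, h0, h1, Complex.conj_I]
    ring

/-- `⟪Π_w x, y⟫ = ⟪x, Π_{wrev w} y⟫`. [folklore] -/
theorem inner_wordOp_left (w : List Bool) (x y : E) :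
    ⟪sys.wordOp w x, y⟫_ℂ = ⟪x, sys.wordOp (wrev w) y⟫_ℂ := by
  induction w generalizing y with
  | nil => simp
  | cons s w ih =>
      rw [wordOp_cons, mul_apply_eq_comp, inner_sgnOp_left, ih, wrev_cons, wordOp_append,
        mul_apply_eq_comp, wordOp_singleton]

/-- `⟪x, Π_w y⟫ = ⟪Π_{wrev w} x, y⟫`. [folklore] -/
theorem inner_wordOp_right (w : List Bool) (x y : E) :
    ⟪x, sys.wordOp w y⟫_ℂ = ⟪sys.wordOp (wrev w) x, y⟫_ℂ := by
  rw [inner_wordOp_left, wrev_wrev]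

/-! ### Norm bounds -/

omit [Fintype Λ] in
/-- `‖1‖ ≤ 1` in `E →L[ℂ] E` (with equality unless `E = 0`). [folklore] -/
theorem norm_one_le_one : ‖(1 : E →L[ℂ] E)‖ ≤ 1 := by
  rw [ContinuousLinearMap.one_def]; exact ContinuousLinearMap.norm_id_le

/-- `‖Π_w‖ ≤ (2 o N)^{|w|}`. [cite: KomaTasaki1994, §5 (5.16)] -/
theorem norm_wordOp_le (w : List Bool) :
    ‖sys.wordOp w‖ ≤ (2 * sys.obar * Fintype.card Λ) ^ w.length := by
  induction w with
  | nil => simpa using norm_one_le_one (E := E)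
  | cons s w ih =>
      rw [wordOp_cons, List.length_cons, pow_succ']
      have h2 : 0 ≤ 2 * sys.obar * Fintype.card Λ := by
        have := sys.obar_pos.le; positivity
      calc ‖sys.sgnOp s * sys.wordOp w‖ ≤ ‖sys.sgnOp s‖ * ‖sys.wordOp w‖ := norm_mul_le _ _
        _ ≤ (2 * sys.obar * Fintype.card Λ) * (2 * sys.obar * Fintype.card Λ) ^ w.length :=
            mul_le_mul (sys.norm_sgnOp_le s) ih (norm_nonneg _) h2

/-- `‖Π_w x‖ ≤ (2 o N)^{|w|} ‖x‖`. [cite: KomaTasaki1994, §5 (5.16)] -/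
theorem norm_wordOp_apply_le (w : List Bool) (x : E) :
    ‖sys.wordOp w x‖ ≤ (2 * sys.obar * Fintype.card Λ) ^ w.length * ‖x‖ :=
  (ContinuousLinearMap.le_opNorm _ _).trans
    (mul_le_mul_of_nonneg_right (sys.norm_wordOp_le w) (norm_nonneg _))

/-! ### The `U(1)` charge calculus -/

/-- `X` carries `C`-charge `q`: `C X - X C = q X` (so `X` maps `C = c` to `C = c + q`).
[cite: KomaTasaki1994, (2.16)] -/
def HasCharge (X : E →L[ℂ] E) (q : ℤ) : Prop := sys.C * X - X * sys.C = (q : ℂ) • X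

/-- `1` has charge `0`. [folklore] -/
theorem hasCharge_one : sys.HasCharge 1 0 := by simp [HasCharge]

/-- `0` has every charge. [folklore] -/
theorem hasCharge_zero (q : ℤ) : sys.HasCharge 0 q := by simp [HasCharge]

/-- (2.16): `O⁺` has charge `+1`, `O⁻` has charge `-1`. [cite: KomaTasaki1994, (2.16)] -/
theorem hasCharge_sgnOp (s : Bool) : sys.HasCharge (sys.sgnOp s) (bsign s) := by
  cases s
  · have h := sys.orderMinus_commutator
    simp only [HasCharge, sgnOp_false, bsign_false, Int.cast_neg, Int.cast_one, neg_smul, one_smul]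
    rw [← neg_sub, h]
  · have h := sys.orderPlus_commutator
    simp only [HasCharge, sgnOp_true, bsign_true, Int.cast_one, one_smul]
    rw [← neg_sub, h, neg_neg]

variable {sys}

/-- Charges add under products. [folklore] -/
theorem HasCharge.mul {X Y : E →L[ℂ] E} {p q : ℤ} (hX : sys.HasCharge X p) (hY : sys.HasCharge Y q) :
    sys.HasCharge (X * Y) (p + q) := by
  unfold HasCharge at *
  have e : sys.C * (X * Y) - X * Y * sys.C = (sys.C * X - X * sys.C) * Y + X * (sys.C * Y - Y * sys.C) := by
    simp only [sub_mul, mul_sub, mul_assoc]; abel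
  rw [e, hX, hY, smul_mul_assoc, mul_smul_comm, Int.cast_add, add_smul]

/-- Sums of charge-`q` operators have charge `q`. [folklore] -/
theorem HasCharge.add {X Y : E →L[ℂ] E} {q : ℤ} (hX : sys.HasCharge X q) (hY : sys.HasCharge Y q) :
    sys.HasCharge (X + Y) q := by
  unfold HasCharge at *
  rw [mul_add, add_mul, add_sub_add_comm, hX, hY, smul_add]

/-- Differences of charge-`q` operators have charge `q`. [folklore] -/
theorem HasCharge.sub {X Y : E →L[ℂ] E} {q : ℤ} (hX : sys.HasCharge X q) (hY : sys.HasCharge Y q) :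
    sys.HasCharge (X - Y) q := by
  unfold HasCharge at *
  rw [mul_sub, sub_mul, sub_sub_sub_comm, hX, hY, smul_sub]

/-- `-X` has the charge of `X`. [folklore] -/
theorem HasCharge.neg {X : E →L[ℂ] E} {q : ℤ} (hX : sys.HasCharge X q) : sys.HasCharge (-X) q := by
  simpa using (sys.hasCharge_zero q).sub hX

/-- `c • X` has the charge of `X`. [folklore] -/
theorem HasCharge.smul {X : E →L[ℂ] E} {q : ℤ} (hX : sys.HasCharge X q) (c : ℂ) :
    sys.HasCharge (c • X) q := by
  unfold HasCharge at *
  rw [mul_smul_comm, smul_mul_assoc, ← smul_sub, hX, smul_comm]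

/-- Finite sums of charge-`q` operators have charge `q`. [folklore] -/
theorem HasCharge.sum {ι : Type*} (s : Finset ι) {f : ι → E →L[ℂ] E} {q : ℤ}
    (h : ∀ i ∈ s, sys.HasCharge (f i) q) : sys.HasCharge (∑ i ∈ s, f i) q := by
  classical
  induction s using Finset.induction_on with
  | empty => simpa using sys.hasCharge_zero q
  | insert a s ha ih =>
      rw [Finset.sum_insert ha]
      exact (h a (Finset.mem_insert_self a s)).add (ih fun i hi => h i (Finset.mem_insert_of_mem hi))

/-- `X^n` has charge `n q`. [folklore] -/
theorem HasCharge.pow {X : E →L[ℂ] E} {q : ℤ} (hX : sys.HasCharge X q) (n : ℕ) :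
    sys.HasCharge (X ^ n) (n * q) := by
  induction n with
  | zero => simpa using sys.hasCharge_one
  | succ n ih =>
      have := ih.mul hX
      rw [pow_succ]
      convert this using 2
      push_cast; ring

/-- The commutator `[O^s, A]` of a charge-`q` operator has charge `q + s`. [cite: KomaTasaki1994, §5 p. 787] -/
theorem HasCharge.comm_sgnOp {A : E →L[ℂ] E} {q : ℤ} (hA : sys.HasCharge A q) (s : Bool) :
    sys.HasCharge (sys.sgnOp s * A - A * sys.sgnOp s) (q + bsign s) := by
  have h1 := (sys.hasCharge_sgnOp s).mul hA
  have h2 := hA.mul (sys.hasCharge_sgnOp s)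
  rw [add_comm] at h1
  exact h1.sub h2

variable (sys)

/-- `Π_w` has charge `charge(w)`. [cite: KomaTasaki1994, §5 p. 785] -/
theorem hasCharge_wordOp (w : List Bool) : sys.HasCharge (sys.wordOp w) (wordCharge w) := by
  induction w with
  | nil => simpa using sys.hasCharge_one
  | cons s w ih =>
      rw [wordOp_cons, wordCharge_cons]
      exact (sys.hasCharge_sgnOp s).mul ih

variable {sys}

/-- On a vector annihilated by `C`, a charge-`q` operator produces a `C`-eigenvector with
eigenvalue `q`: `C (X Φ) = q X Φ` ("`O^±` are the raising and the lowering operators", KT p. 785).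
[cite: KomaTasaki1994, §5 p. 785] -/
theorem HasCharge.C_apply {X : E →L[ℂ] E} {q : ℤ} (hX : sys.HasCharge X q) {Φ : E}
    (hΦ : sys.C Φ = 0) : sys.C (X Φ) = (q : ℂ) • X Φ := by
  have h := congrArg (fun T : E →L[ℂ] E => T Φ) hX
  simp only [sub_apply, mul_apply_eq_comp, hΦ, map_zero, sub_zero,
    smul_apply] at h
  exact h

/-- Expectations of operators with nonzero charge vanish in a state with `C Φ = 0`
(KT: "The constraint comes from the fact that `Φ` is an eigenstate of the `U(1)` generator `C`").
[cite: KomaTasaki1994, §5 (5.26)] -/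
theorem HasCharge.inner_eq_zero {X : E →L[ℂ] E} {q : ℤ} (hX : sys.HasCharge X q) (hq : q ≠ 0)
    {Φ : E} (hΦ : sys.C Φ = 0) : ⟪Φ, X Φ⟫_ℂ = 0 := by
  have h1 : ⟪Φ, sys.C (X Φ)⟫_ℂ = 0 := by
    have h2 : ⟪sys.C Φ, X Φ⟫_ℂ = ⟪Φ, sys.C (X Φ)⟫_ℂ := sys.isSymmetric_C Φ (X Φ)
    rw [← h2, hΦ, inner_zero_left]
  rw [hX.C_apply hΦ, inner_smul_right] at h1
  have hq' : (q : ℂ) ≠ 0 := by exact_mod_cast hq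
  exact (mul_eq_zero.mp h1).resolve_left hq'

/-- `C (Π_w Φ) = charge(w) Π_w Φ` when `C Φ = 0`. [cite: KomaTasaki1994, §5 p. 785] -/
theorem C_wordOp_apply {Φ : E} (hΦ : sys.C Φ = 0) (w : List Bool) :
    sys.C (sys.wordOp w Φ) = (wordCharge w : ℂ) • sys.wordOp w Φ :=
  (sys.hasCharge_wordOp w).C_apply hΦ

/-! ### Local operators -/

/-- **Local operators** (KT p. 784): `A = Σ_{x∈Λ} a_x` with `‖a_x‖ ≤ a` and `[a_x, o_y^{(α)}] = 0`
whenever `y ∉ S_x` (the support set of `h_x`). [cite: KomaTasaki1994, §5 (before Lemma 14)] -/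
def IsLocal (A : E →L[ℂ] E) (a : ℝ) : Prop :=
  ∃ aloc : Λ → (E →L[ℂ] E), A = ∑ x, aloc x ∧ (∀ x, ‖aloc x‖ ≤ a) ∧
    ∀ x y, y ∉ sys.supp x → ∀ α, Commute (aloc x) (sys.o α y)

variable (sys)

/-- The Hamiltonian `H = Σ h_x` is local with constant `h` (hypotheses ii), iii)).
[cite: KomaTasaki1994, §2.3 ii) iii)] -/
theorem isLocal_hamiltonian : sys.IsLocal sys.hamiltonian sys.hbar :=
  ⟨sys.h, rfl, sys.norm_h_le, sys.commute_h_o⟩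

/-- The identity is local with constant `1/N` (`a_x = N⁻¹ 1`); then `δ(1; K, K) = ½ b_K` is the
special case `a N = 1` of the general `δ(A; K, L)` of KT (5.14)–(5.15). [cite: KomaTasaki1994, §5 (5.15)] -/
theorem isLocal_one [Nonempty Λ] : sys.IsLocal 1 ((Fintype.card Λ : ℝ)⁻¹) := by
  refine ⟨fun _ => ((Fintype.card Λ : ℂ))⁻¹ • 1, ?_, ?_, ?_⟩
  · rw [Finset.sum_const, Finset.card_univ, ← Nat.cast_smul_eq_nsmul ℂ, smul_smul,
      mul_inv_cancel₀ (by exact_mod_cast Fintype.card_ne_zero), one_smul]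
  · intro x
    rw [norm_smul, norm_inv, Complex.norm_natCast]
    calc (Fintype.card Λ : ℝ)⁻¹ * ‖(1 : E →L[ℂ] E)‖ ≤ (Fintype.card Λ : ℝ)⁻¹ * 1 := by
          gcongr; exact norm_one_le_one
      _ = (Fintype.card Λ : ℝ)⁻¹ := mul_one _
  · intro x y _ α
    exact (Commute.one_left _).smul_left _

variable {sys}

/-- The constant of a local operator on a nonempty lattice is `≥ 0`. [folklore] -/
theorem IsLocal.nonneg [Nonempty Λ] {A : E →L[ℂ] E} {a : ℝ} (hA : sys.IsLocal A a) : 0 ≤ a := by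
  obtain ⟨aloc, -, hn, -⟩ := hA
  exact (norm_nonneg _).trans (hn (Classical.arbitrary Λ))

/-- `‖A‖ ≤ a N` for a local `A`. [cite: KomaTasaki1994, §5 (5.30)] -/
theorem IsLocal.norm_le {A : E →L[ℂ] E} {a : ℝ} (hA : sys.IsLocal A a) :
    ‖A‖ ≤ a * Fintype.card Λ := by
  obtain ⟨aloc, rfl, hn, -⟩ := hA
  calc ‖∑ x, aloc x‖ ≤ ∑ x, ‖aloc x‖ := norm_sum_le _ _
    _ ≤ ∑ _x : Λ, a := Finset.sum_le_sum fun x _ => hn x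
    _ = a * Fintype.card Λ := by rw [Finset.sum_const, Finset.card_univ, nsmul_eq_mul]; ring

/-- `-A` is local with the same constant. [folklore] -/
theorem IsLocal.neg {A : E →L[ℂ] E} {a : ℝ} (hA : sys.IsLocal A a) : sys.IsLocal (-A) a := by
  obtain ⟨aloc, rfl, hn, hc⟩ := hA
  refine ⟨fun x => -aloc x, by simp, fun x => by rw [norm_neg]; exact hn x, ?_⟩
  intro x y hy α
  exact (hc x y hy α).neg_left

/-- `c • A` is local with constant `|c| a`. [folklore] -/
theorem IsLocal.smul {A : E →L[ℂ] E} {a : ℝ} (hA : sys.IsLocal A a) (c : ℂ) :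
    sys.IsLocal (c • A) (‖c‖ * a) := by
  obtain ⟨aloc, rfl, hn, hc⟩ := hA
  refine ⟨fun x => c • aloc x, by simp [Finset.smul_sum], fun x => ?_, ?_⟩
  · rw [norm_smul]; gcongr; exact hn x
  · intro x y hy α
    exact (hc x y hy α).smul_left c

/-- **Commutators with `O^±` stay local** (KT p. 787): if `A = Σ a_x` is local with constant `a`
then `[O^±, A] = Σ_x [Σ_{y ∈ S_x} o^±_y, a_x]` is local with constant `4 r a o`.
[cite: KomaTasaki1994, §5 p. 787] -/
theorem IsLocal.comm_sgnOp {A : E →L[ℂ] E} {a : ℝ} (hA : sys.IsLocal A a) (s : Bool) :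
    sys.IsLocal (sys.sgnOp s * A - A * sys.sgnOp s) (4 * sys.r * sys.obar * a) := by
  classical
  obtain ⟨aloc, rfl, hn, hc⟩ := hA
  -- the local pieces `[R^s_x, a_x]`, `R^s_x = Σ_{y ∈ S_x} o^s_y`
  set R : Λ → (E →L[ℂ] E) := fun x => ∑ y ∈ sys.supp x, sys.sgnDensity s y with hR
  refine ⟨fun x => R x * aloc x - aloc x * R x, ?_, ?_, ?_⟩
  · -- `[O^s, Σ a_x] = Σ_x [O^s, a_x] = Σ_x [R_x, a_x]`
    rw [Finset.mul_sum, Finset.sum_mul, ← Finset.sum_sub_distrib]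
    refine Finset.sum_congr rfl fun x _ => ?_
    have hsplit : sys.sgnOp s * aloc x - aloc x * sys.sgnOp s =
        ∑ y, (sys.sgnDensity s y * aloc x - aloc x * sys.sgnDensity s y) := by
      rw [sgnOp_eq_sum, Finset.sum_mul, Finset.mul_sum, Finset.sum_sub_distrib]
    rw [hsplit, hR]
    simp only [Finset.sum_mul, Finset.mul_sum, ← Finset.sum_sub_distrib]
    refine (Finset.sum_subset (Finset.subset_univ _) fun y _ hy => ?_).symm
    -- for `y ∉ S_x`, `[o^s_y, a_x] = 0`
    have hcomm : Commute (sys.sgnDensity s y) (aloc x) := by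
      have h0 := (hc x y hy 0).symm
      have h1 := (hc x y hy 1).symm
      cases s
      · exact h0.sub_left (h1.smul_left I)
      · exact h0.add_left (h1.smul_left I)
    exact sub_eq_zero.mpr hcomm.eq
  · intro x
    have ha : 0 ≤ a := (norm_nonneg _).trans (hn x)
    have h2o : 0 ≤ 2 * sys.obar := mul_nonneg zero_le_two sys.obar_pos.le
    have h2or : 0 ≤ 2 * sys.obar * sys.r := mul_nonneg h2o (Nat.cast_nonneg _)
    have hRn : ‖R x‖ ≤ 2 * sys.obar * sys.r := by
      calc ‖R x‖ ≤ ∑ y ∈ sys.supp x, ‖sys.sgnDensity s y‖ := norm_sum_le _ _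
        _ ≤ ∑ _y ∈ sys.supp x, 2 * sys.obar :=
            Finset.sum_le_sum fun y _ => sys.norm_sgnDensity_le s y
        _ = (sys.supp x).card * (2 * sys.obar) := by rw [Finset.sum_const, nsmul_eq_mul]
        _ ≤ sys.r * (2 * sys.obar) := by
            apply mul_le_mul_of_nonneg_right _ h2o
            exact_mod_cast sys.card_supp_le x
        _ = 2 * sys.obar * sys.r := by ring
    calc ‖R x * aloc x - aloc x * R x‖ ≤ ‖R x * aloc x‖ + ‖aloc x * R x‖ := norm_sub_le _ _
      _ ≤ ‖R x‖ * ‖aloc x‖ + ‖aloc x‖ * ‖R x‖ := add_le_add (norm_mul_le _ _) (norm_mul_le _ _)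
      _ ≤ (2 * sys.obar * sys.r) * a + a * (2 * sys.obar * sys.r) :=
          add_le_add (mul_le_mul hRn (hn x) (norm_nonneg _) h2or)
            (mul_le_mul (hn x) hRn (norm_nonneg _) ha)
      _ = 4 * sys.r * sys.obar * a := by ring
  · intro x z hz α
    have h1 : Commute (R x) (sys.o α z) := by
      rw [hR]
      refine Commute.sum_left _ _ _ fun y hy => ?_
      exact sys.commute_sgnDensity_o s (fun h : y = z => hz (h ▸ hy)) α
    have h2 : Commute (aloc x) (sys.o α z) := hc x z hz α
    exact (h1.mul_left h2).sub_left (h2.mul_left h1)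

variable (sys)

/-! ### The `π`-rotation of hypothesis vi) -/

/-- The `π`-rotation about the first axis, `U_Λ = exp[i (π/√γ) O⁽¹⁾_Λ]` (KT hypothesis vi)),
written with Mathlib's `NormedSpace.exp` exactly as in `theorem_2_4`. [cite: KomaTasaki1994, §2.3 vi)] -/
def rotation (γ : ℝ) : E →L[ℂ] E :=
  NormedSpace.exp ((I * ↑(Real.pi / Real.sqrt γ)) • sys.order 0)

/-- Unfolding `rotation`. [cite: KomaTasaki1994, §2.3 vi)] -/
theorem rotation_def (γ : ℝ) :
    sys.rotation γ = NormedSpace.exp ((I * ↑(Real.pi / Real.sqrt γ)) • sys.order 0) := rfl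

/-! ### The quantity `oN` -/

/-- The recurring quantity `o N` (`o` = the norm bound on the `o_x`, `N = |Λ|`).
[cite: KomaTasaki1994, §5] -/
def oN : ℝ := sys.obar * Fintype.card Λ

/-- Unfolding `oN`. [cite: KomaTasaki1994, §5] -/
theorem oN_def : sys.oN = sys.obar * Fintype.card Λ := rfl

/-- `2 o N = 2 (oN)`. [cite: KomaTasaki1994, §5] -/
theorem two_mul_obar_mul_card : 2 * sys.obar * Fintype.card Λ = 2 * sys.oN := by rw [oN]; ring

end U1System

/-! ### The standing hypotheses of Section 5 on the state `Φ` -/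

/-- **Hypotheses of KT Section 5 on the state.** `Φ` is a unit vector with `C Φ = 0` (KT derive
`C Φ = 0` from vi), p. 785; see `U1System.C_apply_eq_zero_of_rotation` in `KomaTasakiTowerExp`),
with the long-range order (2.17) `⟨Φ, (O⁽¹⁾)² Φ⟩ ≥ (μ o N)²`, `0 < μ ≤ 1`, on a nonempty lattice,
for a system satisfying v) `[O⁽¹⁾, O⁽²⁾] = iγ C` (2.23) with `γ > 0`.
[cite: KomaTasaki1994, §2.3 iv) v) vi), §5] -/
structure TowerState (sys : U1System Λ E) (Φ : E) (μ γ : ℝ) : Prop where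
  norm_eq_one : ‖Φ‖ = 1
  C_apply : sys.C Φ = 0
  mu_pos : 0 < μ
  mu_le_one : μ ≤ 1
  gamma_pos : 0 < γ
  card_pos : 0 < Fintype.card Λ
  lro : (μ * sys.obar * Fintype.card Λ) ^ 2 ≤ (⟪Φ, sys.order 0 (sys.order 0 Φ)⟫_ℂ).re
  comm : sys.order 0 * sys.order 1 - sys.order 1 * sys.order 0 = (I * γ) • sys.C

/-! ### The numbers `c_m`, `b_m` of Lemma 13 -/

/-- `c_m = 4^m (m!)² / (2m)! = 4^m / binom(2m, m)`, the coefficient in `b_m` (KT (5.1)).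
[cite: KomaTasaki1994, §5 (5.1)] -/
def cCoef (m : ℕ) : ℝ := 4 ^ m / (Nat.centralBinom m : ℝ)

omit [Fintype Λ] in
/-- Unfolding `cCoef`. [cite: KomaTasaki1994, §5 (5.1)] -/
theorem cCoef_def (m : ℕ) : cCoef m = 4 ^ m / (Nat.centralBinom m : ℝ) := rfl

/-- `b_m := c_m ⟨Φ, (O⁽¹⁾)^{2m} Φ⟩` (KT (5.1)); we take the real part (the quantity is real and
nonnegative, `= c_m ‖(O⁽¹⁾)^m Φ‖²`, see `bm_eq`). [cite: KomaTasaki1994, §5 (5.1)] -/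
def bm (sys : U1System Λ E) (Φ : E) (m : ℕ) : ℝ :=
  cCoef m * (⟪Φ, (sys.order 0 ^ (2 * m)) Φ⟫_ℂ).re

/-- Unfolding `bm`. [cite: KomaTasaki1994, §5 (5.1)] -/
theorem bm_def (sys : U1System Λ E) (Φ : E) (m : ℕ) :
    bm sys Φ m = cCoef m * (⟪Φ, (sys.order 0 ^ (2 * m)) Φ⟫_ℂ).re := rfl

/-! ### The smallness condition (5.12) and the error `δ(A; K, L)` (5.14) of Lemma 14 -/

/-- **Condition (5.12) of Lemmas 14–15** on `n = K + L`:
`(48 r / μ²) (K+L)/N + (3γ / (2 o² μ²)) (K+L)³/N² ≤ 1`. [cite: KomaTasaki1994, §5 Lemma 14 (5.12)] -/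
def KLCond (sys : U1System Λ E) (μ γ : ℝ) (n : ℕ) : Prop :=
  48 * sys.r / μ ^ 2 * ((n : ℝ) / Fintype.card Λ) +
    3 * γ / (2 * sys.obar ^ 2 * μ ^ 2) * ((n : ℝ) ^ 3 / (Fintype.card Λ : ℝ) ^ 2) ≤ 1

/-- Unfolding `KLCond`. [cite: KomaTasaki1994, §5 Lemma 14 (5.12)] -/
theorem klCond_iff (sys : U1System Λ E) (μ γ : ℝ) (n : ℕ) :
    KLCond sys μ γ n ↔ 48 * sys.r / μ ^ 2 * ((n : ℝ) / Fintype.card Λ) +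
      3 * γ / (2 * sys.obar ^ 2 * μ ^ 2) * ((n : ℝ) ^ 3 / (Fintype.card Λ : ℝ) ^ 2) ≤ 1 := Iff.rfl

/-- **The error term of Lemma 14** (KT (5.14)): `δ(A; K, L) = ½ (a N) (2 o N)^{|K-L|} b_J`,
`J = min{K, L}`, for a local operator `A` with constant `a` (for `A = 1`, `a = 1/N` gives KT's
special value (5.15) `δ(1; K, K) = ½ b_K`). [cite: KomaTasaki1994, §5 Lemma 14 (5.14)–(5.15)] -/
def delta (sys : U1System Λ E) (Φ : E) (a : ℝ) (K L : ℕ) : ℝ :=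
  1 / 2 * (a * Fintype.card Λ) * (2 * sys.oN) ^ (max K L - min K L) * bm sys Φ (min K L)

/-- Unfolding `delta`. [cite: KomaTasaki1994, §5 Lemma 14 (5.14)] -/
theorem delta_def (sys : U1System Λ E) (Φ : E) (a : ℝ) (K L : ℕ) :
    delta sys Φ a K L =
      1 / 2 * (a * Fintype.card Λ) * (2 * sys.oN) ^ (max K L - min K L) * bm sys Φ (min K L) := rfl

end Literature.MathematicalPhysics.QuantumLattice.KomaTasaki
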